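import Summits.KontsevichZagierPeriods.KontsevichZagierPeriods.Theorems.HermiteRigidityReductionRigidityBoxTriangleBridge

/-!
# `ReductionRigidity` (stmt-KontsevichZagierPeriods-3407), line `Sketch` (growth line
# `bloch-suslin-rational-dilog`): the negative-argument box–triangle bridge
# (`stub_boxTriangleBridgeNeg`)

Route `KontsevichZagierPeriods/HermiteRigidity`, crux `ReductionRigidity` (stmt-3407), registered
wave-2 sub-goal stub `stub_boxTriangleBridgeNeg`: the twin of the landed `stub_boxTriangleBridge`
(`…BoxTriangleBridge.lean`) at NEGATIVE arguments. For a real ALGEBRAIC parameter `0 < a` (no upper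
bound) it identifies, inside the Kontsevich–Zagier calculus of moves, this crux's BOX syntax for the
dilogarithm at `−a`,

  `[□², −a/(1 + a p₀ p₁)]`   (value `Li₂(−a)`),

with MINUS the TRIANGLE syntax of the crux `OffTetraSectorKernel` (stmt-10557) for `−Li₂(−a)`,

  `[{0 < v < u < a}, 1/(u(1 + v))]`   (`u = w 0`, `v = w 1`; value `∫₀ᵃ log(1 + u) du/u`):

`[□², −a/(1 + a p₀ p₁)] + [{0 < v < u < a}, 1/(u(1 + v))] ∈ KZ.relations`.

Proof: THREE moves.
* Rule (1a): `[□², f] ≡ [(0,1)², f]`, the boundary being Lebesgue-null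
  (`KZ.IntegralRep.of_sub_of_restrict_mem_relations`).
* Rule (1b): `[(0,1)², f] + [(0,1)², −f] ≡ 0` (`KZ.of_add_of_mem_relations_of_eqOn_neg`).
* Rule (2): the chart `Φ(p, q) = (a p, a p q)` of the landed bridge (helpers
  `boxTriangle_map_image/_isSemialgebraicMapOn/_hasFDerivAt_det/_injOn`) maps `(0,1)²` onto
  `{0 < v < u < a}`, has Jacobian `a² p > 0`, and pulls `du dv/(u(1 + v))` back to
  `a² p/((a p)(1 + a p q)) = a/(1 + a p q) = −f`. Here `1 + a p q ≥ 1` on the square, so no upper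
  bound on `a` is needed.

References: M. Kontsevich, D. Zagier, *Periods* (2001), §1.2 rules (1), (2)
[cite: KontsevichZagier2001, §1.2]. No definitions are introduced.
-/

noncomputable section

open MeasureTheory Set MvPolynomial

namespace Summit.KontsevichZagierPeriods.HermiteRigidity.ReductionRigidity

open Literature.NumberTheory.Transcendental
open Literature.NumberTheory.Transcendental.KZ
open Literature.ModelTheory.ExponentialFields (IsSemialgebraic)

/-- The Jacobian identity behind rule (2) at negative argument (`a ≠ 0`, `p ≠ 0`,
`1 + a p q ≠ 0`): `−(−a/(1 + a p q)) = [1/(u(1 + v))](a p, a p q) · (a² p)`. [folklore] -/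
theorem boxTriangleNeg_jacobian_identity {a p q : ℝ} (ha : a ≠ 0) (hp : p ≠ 0)
    (h : 1 + a * p * q ≠ 0) :
    -(-a / (1 + a * p * q)) = 1 / (a * p * (1 + a * p * q)) * (a ^ 2 * p) := by
  field_simp

/-- On the closed square the denominator `1 + a p₀ p₁` is at least `1` for `0 ≤ a`. [folklore] -/
theorem boxTriangleNeg_den_pos {a : ℝ} (ha : 0 ≤ a) {p : Fin 2 → ℝ} (hp : p ∈ cube 2) :
    0 < 1 + a * p 0 * p 1 := by
  have h : 0 ≤ a * p 0 * p 1 := mul_nonneg (mul_nonneg ha (hp 0).1) (hp 1).1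
  linarith

/-- **Registered stub `stub_boxTriangleBridgeNeg`** (wave 2 of the growth line
`bloch-suslin-rational-dilog` of crux `ReductionRigidity`, stmt-KontsevichZagierPeriods-3407): THE
NEGATIVE-ARGUMENT BOX–TRIANGLE BRIDGE
`[□², −a/(1 + a p₀ p₁)] + [{0 < v < u < a}, 1/(u(1 + v))] ∈ KZ.relations` for real algebraic `0 < a`,
inside the calculus of moves: restriction of the box to the open square (null boundary, rule (1a)),
sign flip of the integrand (rule (1b)), and ONE change of variables along `Φ(p, q) = (a p, a p q)`
(rule (2)), `ℚ`-semialgebraic since `a` is real algebraic, injective, of Jacobian `a² p > 0`, with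
image the triangle, pulling `du dv/(u(1 + v))` back to `a dp dq/(1 + a p q)`.
[cite: KontsevichZagier2001, §1.2] -/
theorem stub_boxTriangleBridgeNeg : ∀ (a : ℝ), IsAlgebraic ℚ a → 0 < a →
    ∀ (r T : IntegralRep 2), r.domain = cube 2 →
    EqOn r.integrand (fun p => -a / (1 + a * p 0 * p 1)) (cube 2) →
    T.domain = {w | 0 < w 1 ∧ w 1 < w 0 ∧ w 0 < a} →
    EqOn T.integrand (fun w => 1 / (w 0 * (1 + w 1))) {w | 0 < w 1 ∧ w 1 < w 0 ∧ w 0 < a} →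
    KZ.of r + KZ.of T ∈ KZ.relations := by
  intro a ha ha0 r T hrd hri hTd hTi
  -- the chart
  set Φ : (Fin 2 → ℝ) → (Fin 2 → ℝ) := fun p => ![a * p 0, a * p 0 * p 1]
  have hΦ : ∀ p, Φ p = ![a * p 0, a * p 0 * p 1] := fun _ => rfl
  -- rule (1a): restrict the box to the open square (null boundary)
  have hOr : openUnitCube 2 ⊆ r.domain := by
    rw [hrd]
    exact openUnitCube_subset_cube
  obtain ⟨R, hRd, hRi, h1⟩ : ∃ R : IntegralRep 2, R.domain = openUnitCube 2 ∧
      R.integrand = r.integrand ∧ KZ.of r - KZ.of R ∈ KZ.relations :=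
    ⟨r.restrict _ isSemialgebraic_openUnitCube hOr, rfl, rfl,
      r.of_sub_of_restrict_mem_relations isSemialgebraic_openUnitCube hOr (by
        rw [hrd]
        exact Summit.KontsevichZagierPeriods.FurushoPentagon.PentagonInKZ.SimplexToCube.volume_cube_diff_openUnitCube
          2)⟩
  -- rule (1b): flip the sign of the integrand
  obtain ⟨N, hNd, hNi, h2⟩ : ∃ N : IntegralRep 2, N.domain = openUnitCube 2 ∧
      N.integrand = -r.integrand ∧ KZ.of R + KZ.of N ∈ KZ.relations :=
    ⟨R.neg, hRd, by rw [IntegralRep.integrand_neg, hRi],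
      of_add_of_mem_relations_of_eqOn_neg rfl fun _ _ => rfl⟩
  -- the data of the move
  have hsa : IsSemialgebraicMapOn ℚ N.domain Φ := by
    rw [hNd]
    exact boxTriangle_map_isSemialgebraicMapOn ha Φ hΦ isSemialgebraic_openUnitCube
  have hinj : InjOn Φ N.domain := by
    rw [hNd]
    exact boxTriangle_map_injOn ha0.ne' Φ hΦ
  have himage : T.domain = Φ '' N.domain := by
    rw [hNd, hTd]
    exact (boxTriangle_map_image ha0 Φ hΦ).symm
  choose Φ' hΦ'd hΦ'det using boxTriangle_map_hasFDerivAt_det a Φ hΦ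
  -- rule (2): `[N] − [T]` is one change-of-variables move
  have h3 : KZ.of N - KZ.of T ∈ KZ.relations := by
    refine changeOfVariablesRel_subset_relations
      ⟨2, N, T, Φ, Φ', hsa, fun x _ => (hΦ'd x).hasFDerivWithinAt, hinj, himage,
        fun x hx => ?_, rfl⟩
    rw [hNd] at hx
    obtain ⟨h0, -, h1', -⟩ := boxTriangle_mem_open hx
    have hxc : x ∈ cube 2 := openUnitCube_subset_cube hx
    have hden : 0 < 1 + a * x 0 * x 1 := boxTriangleNeg_den_pos ha0.le hxc
    have hxT : Φ x ∈ {w : Fin 2 → ℝ | 0 < w 1 ∧ w 1 < w 0 ∧ w 0 < a} := by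
      rw [← boxTriangle_map_image ha0 Φ hΦ]
      exact mem_image_of_mem Φ hx
    have hpos : 0 < a ^ 2 * x 0 := mul_pos (pow_pos ha0 2) h0
    rw [hNi, Pi.neg_apply, hri hxc, hTi hxT, hΦ'det x, abs_of_pos hpos]
    show -(-a / (1 + a * x 0 * x 1)) = 1 / (Φ x 0 * (1 + Φ x 1)) * (a ^ 2 * x 0)
    rw [(boxTriangle_map_apply a Φ hΦ x).1, (boxTriangle_map_apply a Φ hΦ x).2]
    exact boxTriangleNeg_jacobian_identity ha0.ne' h0.ne' hden.ne'
  -- assemble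
  have hsum : KZ.of r + KZ.of T =
      (KZ.of r - KZ.of R) + (KZ.of R + KZ.of N) - (KZ.of N - KZ.of T) := by abel
  rw [hsum]
  exact KZ.relations.sub_mem (KZ.relations.add_mem h1 h2) h3

end Summit.KontsevichZagierPeriods.HermiteRigidity.ReductionRigidity

end
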